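import Literature.MathematicalPhysics.QuantumFieldTheory.Balaban1983to89.B9SupplySockB9P3ZdAllLettersZd
import Literature.MathematicalPhysics.QuantumFieldTheory.Balaban1983to89.B9Eq321LandauNonVacuityZd
import Literature.MathematicalPhysics.QuantumFieldTheory.Balaban1983to89.B9Eq316TowerFlatIsOneStep
import Literature.MathematicalPhysics.QuantumFieldTheory.Balaban1983to89.B9Eq347GlobalFromLocalZd

/-!
# `Balaban1983to89.B9Eq326DeltaAHermitianZd` — [Balaban1985BackgroundPropagators] p. 391 «functions defined on bonds with values in the algebra 𝔤 of hermitian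
# matrices», (3.26) «Δ_a = Δ + DRD* + Q*aQ», (3.10) «Δ = D*D + Δ′»: THE GENUINE FOUR-LETTER `Δ_a(U₀)` OF THE JUNCTION (`deltaAOf η (opsAllZd …) U₀`) MAPS HERMITIAN
# BOND FIELDS TO HERMITIAN BOND FIELDS — letter by letter at every UNITARY background for `D*D` (`Jcur`), `Δ′` (`DpZd`), `D R(U₀) 𝟙D*` (`opsLandau`'s letter,
# finite `Ω₀`), and at the FLAT background `U₀ = 1` for `Q*aQ` (`QQZdP`): dag-n06-b's displayed `HermPreservingAt` at `U₀ = 1`, unfolded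

statement-level skeleton of published theorems with citation tags; proofs where landed; nothing here is a claim about the
Yang–Mills mass gap

PDF held: `paper:balaban1985-cmp99-background-propagators` (journal page = PDF page + 388): p. 391 (the algebra 𝔤; «X·Y = tr XY»), (3.10) p. 392, (3.16) p. 393,
(3.20)–(3.27) pp. 394–395.  BY NAME (nothing restated): dag-n06-w4's `opsAllZd` ∕ `opsLandau` ∕ `projR` ∕ `projE_apply_isSelfAdjoint` (R(U₀) lands in 𝔤-valued
functions), lit-balaban's `B9Eq310Hermitian.star_deltaPrimeOp` (Δ′ commutes with the involution), `B9Eq321LandauProjectionZd.star_covDeriv(Fwd)`, dag-n06-b's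
`QQZdP` ∕ `linCovIterT` ∕ `entryT` ∕ `clsField` ∕ `tauForm`, `B9Eq316TowerFlatIsOneStep.linCovIter_one_left` + `B7Prop4Flat.linQIter` (the flat averaging),
`B8Eq155JBound.Jcur`, `B8Eq146AExpansion.plaqCovDeriv_eq_covDerivFwd`.

WHY THIS FILE (cell `pub-ymgap`, HUMAN RULING D-0062 ∕ D-0149; seat `pub-ymgap-dag-n06-w2` (g2), node N06 = [B9]; CLAIM-9 ∕ INTENT-11; count-neutral).  The per-member road to
[B9] Thm 3.11 runs on the Hermitian sub-carrier `E_𝔤(Ω₀)` (dag-n06-b g18: the 𝔸-valued carrier has skew-Hermitian zero modes; `…SkewGaugeMode`, `…GreenZdHerm`);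
there `RegularAtH ∕ InvAtH` at `U₀ = 1` need, besides positivity (n06-b's `flat_posDef_herm_cube`), that `Δ_a(1)` PRESERVES Hermitian fields (`HermPreservingAt`, displayed)
and is linear (`LinearOnDomAt`, dag-n06-w4).  This file proves the preservation: three letters at every unitary background, the averaging letter at the flat one
(where the composite covariant averages are the flat linear ones, whose τ-transposed entries are Hermitian by a pairing argument).

WHAT IS PROVED (0 sorry; proof lane — no `def`).
* §1 fibre: `tauForm_star_left` (`⟨a*, X⟩_τ = ⟨a, X*⟩_τ`, τ tracial + Hermitian) · ★ `isSelfAdjoint_entryT` (the τ-transpose of a real-linear STAR-COMPATIBLE map sends Hermitian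
  to Hermitian; faithful Hermitian tracial τ) · `isSelfAdjoint_sum`.
* §2 letters at a unitary background: `star_plaqCovDeriv` · ★ `star_Jcur` · ★ `star_DpZd` · `isSelfAdjoint_projR` · ★ `isSelfAdjoint_DRDs_opsLandau`
  (finite `Ω₀`; for EVERY input field).
* §3 the flat averaging: `star_stepA` · `star_asum` · `star_linQ` · ★ `star_linQIter` · `bump_add` · `bump_smul` · `star_bump` · `linQIter_rsmul` ·
  ★ `isSelfAdjoint_linCovIterT_one` · `exists_bound_of_mem_domSub` · ★ `isSelfAdjoint_clsField_one` · ★★ `isSelfAdjoint_QQZdP_one`.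
* §4 ★★★ `isSelfAdjoint_deltaAOf_opsAllZd_one` — for `𝔸` finite-dimensional with a faithful Hermitian tracial `τ`, `1 ≤ L`, a member with finite `Ω₀`, and `A ∈ E(Ω₀)`
  Hermitian-valued: `Δ_a(1)A` is Hermitian-valued at every bond (= n06-b's `HermPreservingAt i.η (opsAllZd τ L ΛbP ops₀ M i m) (i.Ω 0) 1`, unfolded);
  ★★ `isSelfAdjoint_deltaAOf_opsAllZd_of_QQ` — at every UNITARY `U₀` modulo the displayed Hermiticity of the averaging letter's value.
HONEST SCOPE.  Involution bookkeeping; the averaging letter at a curved unitary background needs the reality of the linearised covariant average `linQcov = ∂_t Q(V₀)(tA)|₀`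
(a [Balaban1985Averaging] Prop. 3 fact not in the tree) — displayed, not proved; nothing of Thm 3.11 asserted.  Count-neutral; N05∕N06 NOT discharged; one finite
lattice programme at fixed `ε`; R4 closes the conditional finite-𝕋⁴ rung `BalabanLadder.UV` only; nothing continuum ∕ ℝ⁴ ∕ OS ∕ mass-gap ∕ Clay.  Unit `pub-ymgap-dag-n06-w2` (g2), 2026-08-28.
-/

noncomputable section

namespace Literature.MathematicalPhysics.QuantumFieldTheory.Balaban1983to89.B9Eq326DeltaAHermitianZd

open B7Prop1Explicit (stepA asum)
open B7Prop2Explicit (unitaryUnits)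
open B7Prop3Flat (linQ)
open B7Prop4Flat (linQIter linQIter_succ)
open B7Prop4GeneralLevels (linCovIter)
open B7Prop5Flat (bump)
open B7Eq78Linearization (conjR conjR_apply)
open B8Ineq132 (covDerivFwd covDeriv BondTouches)
open B8Eq133Hypotheses (shiftT byDir)
open B8Eq146AExpansion (plaqCovDeriv plaqCovDeriv_eq_covDerivFwd iEta)
open B8Eq155JBound (Jcur)
open B8Eq143PlaqExpansion (pdiv)
open B8LeafModelZd (ZdIdx)
open B8Eq138LandauZd (covDivB)
open B9Eq369CurvSmallZd (DpZd)
open B9SupplySockB9P3ZdLetters (OpsZd deltaAOf)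
open B9Eq316AveragingTransposeZd (tauForm entryT linCovIterT clsField wQ Reg17 tauForm_nondegenerate tauForm_entryT)
open B9Eq316AveragingTransposeZdPrinted (QQZdP withQQP)
open B9Eq321LandauProjectionZd (suppSub projE projR opsLandau opsLandau_DRDs_of_finite star_covDerivFwd star_covDeriv)
open B9Eq321LandauNonVacuityZd (projE_apply_isSelfAdjoint)
open B9Eq327GreenZd (domSub)
open B9SupplySockB9P3ZdAllLettersZd (opsAllZd)
open B9SupplySockB9P3ZdGammaInAkDpZd (withDpZd)

-- `Site` alone could resolve to the torus sites of `Setup.lean`; re-export the `ℤ^d` sites of `B7Prop1Explicit`.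
export B7Prop1Explicit (Site)

variable {d : ℕ} {𝔸 : Type*} [CStarAlgebra 𝔸]

/-! ## §1 The fibre: the τ-pairing and the involution -/

section Fibre

variable (τ : 𝔸 →ₗ[ℂ] ℂ)

/-- **`⟨a*, X⟩_τ = ⟨a, X*⟩_τ`** for a tracial (`τ(ab) = τ(ba)`) Hermitian (`τ(a*) = conj τ(a)`) functional: `Re τ(aX) = Re τ(a*X*)`.
[cite: Balaban1985BackgroundPropagators, p.391 («X·Y = tr XY», the real pairing of hermitian matrices)] -/
theorem tauForm_star_left (hτt : ∀ a b : 𝔸, τ (a * b) = τ (b * a)) (hτs : ∀ a : 𝔸, τ (star a) = starRingEnd ℂ (τ a)) (a X : 𝔸) :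
    tauForm τ (star a) X = tauForm τ a (star X) := by
  simp only [B9Eq316AveragingTransposeZd.tauForm_apply, star_star]
  have h : star a * star X = star (X * a) := by rw [star_mul]
  rw [h, hτs, Complex.conj_re, hτt]

variable [FiniteDimensional ℝ 𝔸]

/-- ★ **THE τ-TRANSPOSE OF A REAL-LINEAR STAR-COMPATIBLE MAP SENDS HERMITIAN TO HERMITIAN**: for a faithful Hermitian tracial `τ`, a map `E : 𝔸 → 𝔸` that is additive,
real-homogeneous and commutes with the involution (`E(X*) = (E X)*`), and a Hermitian `v`: `Eᵀv` is Hermitian — `⟨(Eᵀv)*, X⟩ = ⟨Eᵀv, X*⟩ = ⟨v, E X*⟩ = ⟨v, (EX)*⟩ = ⟨v*, EX⟩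
= ⟨Eᵀv, X⟩` and non-degeneracy. [cite: Balaban1985BackgroundPropagators, (3.16) p.393 («an operator Q*aQ» on 𝔤-valued fields), p.391] -/
theorem isSelfAdjoint_entryT (hτp : ∀ a : 𝔸, a ≠ 0 → 0 < (τ (star a * a)).re) (hτt : ∀ a b : 𝔸, τ (a * b) = τ (b * a))
    (hτs : ∀ a : 𝔸, τ (star a) = starRingEnd ℂ (τ a)) {E : 𝔸 → 𝔸}
    (hEadd : ∀ x y, E (x + y) = E x + E y) (hEsmul : ∀ (c : ℝ) x, E (c • x) = c • E x) (hEstar : ∀ x, E (star x) = star (E x))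
    {v : 𝔸} (hv : IsSelfAdjoint v) : IsSelfAdjoint (entryT τ E v) := by
  have hN : (tauForm τ).SeparatingLeft := (tauForm_nondegenerate τ hτp).1
  rw [IsSelfAdjoint, ← sub_eq_zero]
  refine hN _ fun X => ?_
  rw [map_sub, LinearMap.sub_apply, sub_eq_zero, tauForm_star_left τ hτt hτs, tauForm_entryT τ hτp hEadd hEsmul,
    tauForm_entryT τ hτp hEadd hEsmul, hEstar, ← tauForm_star_left τ hτt hτs, hv.star_eq]

end Fibre

/-- a real multiple of a Hermitian element is Hermitian (cf. `B8Prop5Reality.isSelfAdjoint_real_smul`, not imported to keep the closure small).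
[cite: Balaban1985BackgroundPropagators, p.391 (𝔤 is a real vector space)] -/
private theorem isSelfAdjoint_rsmul (r : ℝ) {x : 𝔸} (hx : IsSelfAdjoint x) : IsSelfAdjoint (r • x) := by
  rw [IsSelfAdjoint, ← Complex.coe_smul, star_smul, Complex.star_def, Complex.conj_ofReal, hx.star_eq]

/-- a finite sum of Hermitian elements is Hermitian. [cite: Balaban1985BackgroundPropagators, p.391 (𝔤 is a real vector space)] -/
theorem isSelfAdjoint_sum {ι : Type*} (s : Finset ι) {f : ι → 𝔸} (hf : ∀ i ∈ s, IsSelfAdjoint (f i)) : IsSelfAdjoint (∑ i ∈ s, f i) := by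
  rw [IsSelfAdjoint, star_sum]
  exact Finset.sum_congr rfl fun i hi => (hf i hi).star_eq

/-! ## §2 The letters `D*D`, `Δ′`, `D R(U₀) 𝟙D*` at a unitary background -/

section Unitary

variable {η : ℝ} {U₀ : Site d → Fin d → 𝔸ˣ}

/-- for a unitary unit `u`, `u⁻¹ = u*`. [cite: Balaban1985BackgroundPropagators, (3.1) p.390 (U(b) ∈ G unitary)] -/
private theorem inv_coe_eq_star {u : 𝔸ˣ} (hu : u ∈ unitaryUnits 𝔸) : ((u⁻¹ : 𝔸ˣ) : 𝔸) = star (u : 𝔸) :=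
  Units.inv_eq_of_mul_eq_one_right (Unitary.mul_star_self_of_mem (show (u : 𝔸) ∈ unitary 𝔸 from hu))

/-- `(D^η_{U₀}A)(p)* = (D^η_{U₀}A*)(p)` — the plaquette covariant derivative (3.4) commutes with the involution at a unitary background.
[cite: Balaban1985BackgroundPropagators, (3.4) p.391; Balaban1985RegularSpaces, (1.1) p.76] -/
theorem star_plaqCovDeriv (hU : ∀ (x : Site d) (κ : Fin d), U₀ x κ ∈ unitaryUnits 𝔸) (A : Site d → Fin d → 𝔸) (μ ν : Fin d) (x : Site d) :
    star (plaqCovDeriv η U₀ A μ ν x) = plaqCovDeriv η U₀ (star A) μ ν x := by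
  rw [plaqCovDeriv_eq_covDerivFwd, plaqCovDeriv_eq_covDerivFwd, star_sub, star_covDerivFwd η hU, star_covDerivFwd η hU]
  rfl

/-- ★ **`(D*_{U₀}D_{U₀}A)* = D*_{U₀}D_{U₀}(A*)`** — the `D*D` part of (3.10) (B8's current `J`, (1.55)) commutes with the involution at a unitary background; in particular it
maps Hermitian bond fields to Hermitian ones. [cite: Balaban1985BackgroundPropagators, (3.10) p.392, p.391; Balaban1985RegularSpaces, (1.55) p.86] -/
theorem star_Jcur (hU : ∀ (x : Site d) (κ : Fin d), U₀ x κ ∈ unitaryUnits 𝔸) (A : Site d → Fin d → 𝔸) (μ : Fin d) (x : Site d) :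
    star (Jcur η U₀ A μ x) = Jcur η U₀ (star A) μ x := by
  simp only [Jcur, pdiv, star_sub, star_sum, star_covDeriv η hU]
  congr 1
  · refine Finset.sum_congr rfl fun ν _ => ?_
    congr 1
    funext z
    exact star_plaqCovDeriv hU A ν μ z
  · refine Finset.sum_congr rfl fun ν _ => ?_
    congr 1
    funext z
    exact star_plaqCovDeriv hU A μ ν z

/-- ★ **`(Δ′(U₀)A)* = Δ′(U₀)(A*)`** on the `ℤᵈ` carrier — lit-balaban's `star_deltaPrimeOp` ((3.10)'s commutator form) read through `DpZd`; Hermitian in, Hermitian out.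
[cite: Balaban1985BackgroundPropagators, (3.10) p.392, p.391] -/
theorem star_DpZd (hU : ∀ (x : Site d) (κ : Fin d), U₀ x κ ∈ unitaryUnits 𝔸) (A : Site d → Fin d → 𝔸) (x : Site d) (μ : Fin d) :
    star (DpZd η U₀ A x μ) = DpZd η U₀ (star A) x μ := by
  rw [DpZd, DpZd]
  exact B9Eq310Hermitian.star_deltaPrimeOp (shiftT d) (byDir U₀) (fun κ z => inv_coe_eq_star (hU z κ)) η (byDir A) μ x

variable (τ : 𝔸 →ₗ[ℂ] ℂ) [FiniteDimensional ℝ 𝔸]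

/-- **`R(U₀)f` IS HERMITIAN-VALUED FOR EVERY `f`** (dag-n06-w4's `projE_apply_isSelfAdjoint`, read through `projR`): the orthogonal projection onto `Δ^η_{U₀}N_𝔤(Q′)` lands in the
real span of Hermitian-valued generators. [cite: Balaban1985BackgroundPropagators, (3.21)–(3.22) p.394 («L²(Ω₀, 𝔤)»)] -/
theorem isSelfAdjoint_projR (s : Finset (Site d)) (L m : ℕ) (Λs : ℕ → Set (Site d))
    (hτs : ∀ a : 𝔸, τ (star a) = starRingEnd ℂ (τ a)) (hτp : ∀ a : 𝔸, a ≠ 0 → 0 < (τ (star a * a)).re)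
    (hU : ∀ (x : Site d) (κ : Fin d), U₀ x κ ∈ unitaryUnits 𝔸) (f : Site d → 𝔸) (x : Site d) :
    IsSelfAdjoint (projR τ s L m η Λs U₀ f x) :=
  projE_apply_isSelfAdjoint (τ := τ) (s := s) (L := L) (m := m) (η := η) (Λs := Λs) (U₀ := U₀) hτs hτp hU _ x

/-- ★ **THE LETTER `D R(U₀) 𝟙_{Ω₀}D*` IS HERMITIAN-VALUED FOR EVERY INPUT** at a member with finite `Ω₀` and a unitary background: `R(U₀)(𝟙D*A)` is Hermitian-valued
(`isSelfAdjoint_projR`) and `D^η_{U₀,μ}` preserves Hermitian functions. [cite: Balaban1985BackgroundPropagators, (3.26) p.395 («D^η_U R(U) D^{η*}_U»), (3.21)–(3.22) p.394] -/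
theorem isSelfAdjoint_DRDs_opsLandau {L : ℕ} (ops₁ : ℝ → ZdIdx d L → ℕ → OpsZd d 𝔸) (M : ℝ) (i : ZdIdx d L) (m : ℕ) (hΩ : (i.Ω 0).Finite)
    (hτs : ∀ a : 𝔸, τ (star a) = starRingEnd ℂ (τ a)) (hτp : ∀ a : 𝔸, a ≠ 0 → 0 < (τ (star a * a)).re)
    (hU : ∀ (x : Site d) (κ : Fin d), U₀ x κ ∈ unitaryUnits 𝔸) (A : Site d → Fin d → 𝔸) (x : Site d) (μ : Fin d) :
    IsSelfAdjoint ((opsLandau τ ops₁ M i m).DRDs U₀ A x μ) := by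
  rw [opsLandau_DRDs_of_finite τ ops₁ M i m hΩ, IsSelfAdjoint, star_covDerivFwd i.η hU]
  congr 1
  funext z
  exact (isSelfAdjoint_projR τ hΩ.toFinset L m (i.Λs m) hτs hτp hU _ z).star_eq

end Unitary

/-! ## §3 The averaging letter at the flat background -/

section Flat

/-- the signed bond term of a contour sum commutes with the involution. [cite: Balaban1985Averaging, p.24 (A(Γ))] -/
theorem star_stepA (A : Site d → Fin d → 𝔸) (x : Site d) (l : B7Prop1Explicit.Letter d) : star (stepA A x l) = stepA (star A) x l := by
  unfold stepA
  split_ifs <;> simp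

/-- `A(Γ)* = A*(Γ)`. [cite: Balaban1985Averaging, p.24 (A(Γ))] -/
theorem star_asum (A : Site d → Fin d → 𝔸) : ∀ (x : Site d) (w : List (B7Prop1Explicit.Letter d)), star (asum A x w) = asum (star A) x w
  | x, [] => by simp
  | x, l :: w => by rw [B7Prop1Explicit.asum_cons, B7Prop1Explicit.asum_cons, star_add, star_stepA, star_asum A _ w]

/-- `(L·Q₀A)_c* = (L·Q₀A*)_c` — the flat one-step linear average (125) has real coefficients. [cite: Balaban1985Averaging, (125) p.36] -/
theorem star_linQ (L : ℕ) (A : Site d → Fin d → 𝔸) (q : Site d) (κ : Fin d) : star (linQ L A q κ) = linQ L (star A) q κ := by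
  simp only [linQ, star_sum, star_smul, star_trivial, star_asum]

/-- ★ **`(LʲηQ_j(1)A)* = LʲηQ_j(1)(A*)`** — the flat composite linear average (127) commutes with the involution. [cite: Balaban1985Averaging, (127) p.37, (125) p.36] -/
theorem star_linQIter (L : ℕ) (A : Site d → Fin d → 𝔸) : ∀ (j : ℕ) (z : Site d) (κ : Fin d), star (linQIter L A j z κ) = linQIter L (star A) j z κ
  | 0, _, _ => rfl
  | j + 1, z, κ => by
    have hfun : star (linQIter L A j) = linQIter L (star A) j := funext fun z' => funext fun κ' => star_linQIter L A j z' κ'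
    rw [linQIter_succ, linQIter_succ, star_linQ, hfun]

/-- the single-bond field is additive in its value. [cite: Balaban1985Averaging, (147) p.40 (the column X ↦ Q(X·δ_b))] -/
theorem bump_add (y : Site d) (μ : Fin d) (X Y : 𝔸) : bump y μ (X + Y) = bump y μ X + bump y μ Y := by
  funext x κ
  simp only [bump, Pi.add_apply]
  split_ifs <;> simp

/-- the single-bond field is real-homogeneous in its value. [cite: Balaban1985Averaging, (147) p.40] -/
theorem bump_smul (y : Site d) (μ : Fin d) (c : ℝ) (X : 𝔸) : bump y μ (c • X) = c • bump y μ X := by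
  funext x κ
  simp only [bump, Pi.smul_apply]
  split_ifs <;> simp

/-- the single-bond field commutes with the involution. [cite: Balaban1985Averaging, (147) p.40] -/
theorem star_bump (y : Site d) (μ : Fin d) (X : 𝔸) : star (bump y μ X) = bump y μ (star X) := by
  funext x κ
  simp only [bump, Pi.star_apply]
  split_ifs <;> simp

/-- the flat composite is real-homogeneous (from `B7Prop4Flat.linQIter_csmul`). [cite: Balaban1985Averaging, (127) p.37] -/
theorem linQIter_rsmul (L : ℕ) (c : ℝ) (A : Site d → Fin d → 𝔸) (j : ℕ) (z : Site d) (κ : Fin d) :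
    linQIter L (c • A) j z κ = c • linQIter L A j z κ := by
  have h1 : c • A = (c : ℂ) • A := by funext x ν; simp only [Pi.smul_apply, Complex.coe_smul]
  rw [h1, B7Prop4Flat.linQIter_csmul, Complex.coe_smul]

variable (τ : 𝔸 →ₗ[ℂ] ℂ)

/-- ★ **AT `U₀ = 1` THE TRANSPOSED AVERAGING `Q_jᵀB` OF A HERMITIAN-VALUED `B` IS HERMITIAN-VALUED** (faithful Hermitian tracial `τ`, `1 ≤ L`): each entry is the τ-transpose of
the column `X ↦ LʲηQ_j(1)(X·δ_b)(c)`, which at the flat background is the flat composite (`linCovIter_one_left`) — additive, real-homogeneous, star-compatible — applied to a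
Hermitian value (`isSelfAdjoint_entryT`). [cite: Balaban1985BackgroundPropagators, (3.16) p.393; Balaban1985Averaging, (127) p.37, (147) p.40] -/
theorem isSelfAdjoint_linCovIterT_one [FiniteDimensional ℝ 𝔸] [Nontrivial 𝔸] {L : ℕ} (hL : 1 ≤ L) (hτp : ∀ a : 𝔸, a ≠ 0 → 0 < (τ (star a * a)).re)
    (hτt : ∀ a b : 𝔸, τ (a * b) = τ (b * a)) (hτs : ∀ a : 𝔸, τ (star a) = starRingEnd ℂ (τ a)) (j : ℕ) {B : Site d → Fin d → 𝔸}
    (hB : ∀ w κ, IsSelfAdjoint (B w κ)) (y : Site d) (μ : Fin d) :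
    IsSelfAdjoint (linCovIterT τ L (1 : Site d → Fin d → 𝔸ˣ) j B y μ) := by
  unfold linCovIterT
  refine isSelfAdjoint_sum _ fun κ _ => isSelfAdjoint_sum _ fun t _ => ?_
  have hflat : ∀ X : 𝔸, linCovIter L (1 : Site d → Fin d → 𝔸ˣ) (bump y μ X) j = linQIter L (bump y μ X) j := fun X =>
    B9Eq316TowerFlatIsOneStep.linCovIter_one_left L hL (bump y μ X) (norm_nonneg X) (B7Prop5Flat.norm_bump_le y μ X) j
  refine isSelfAdjoint_entryT τ hτp hτt hτs (fun X Y => ?_) (fun c X => ?_) (fun X => ?_) (hB _ κ)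
  · rw [hflat, hflat, hflat, bump_add]
    have := B7Prop5Flat.linQIter_add L (bump y μ X) (bump y μ Y) j (B9Eq316AveragingTransposeZd.winBase L j y κ t) κ
    rw [this]
  · rw [hflat, hflat, bump_smul, linQIter_rsmul]
  · rw [hflat, hflat, ← star_bump, star_linQIter]

/-- a field of `E(Ω₀)` at a member with finite `Ω₀` is bounded (finitely many bonds touch `Ω₀`). [cite: Balaban1985BackgroundPropagators, (3.27) p.395 (E(Ω₀)); Balaban1985RegularSpaces, p.77 (bond convention)] -/
theorem exists_bound_of_mem_domSub {Ω₀ : Set (Site d)} (hΩ : Ω₀.Finite) {A : Site d → Fin d → 𝔸} (hA : A ∈ domSub (𝔸 := 𝔸) Ω₀) :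
    ∃ b : ℝ, 0 ≤ b ∧ ∀ z κ, ‖A z κ‖ ≤ b := by
  classical
  have hfin := B9Eq347GlobalFromLocalZd.finite_bondTouches (d := d) hΩ
  refine ⟨∑ b ∈ hfin.toFinset, ‖A b.1 b.2‖, Finset.sum_nonneg fun _ _ => norm_nonneg _, fun z κ => ?_⟩
  by_cases hb : BondTouches Ω₀ z κ
  · have hmem : (z, κ) ∈ hfin.toFinset := by rw [Set.Finite.mem_toFinset]; exact hb
    exact Finset.single_le_sum (f := fun b : Site d × Fin d => ‖A b.1 b.2‖) (fun _ _ => norm_nonneg _) hmem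
  · rw [hA z κ hb, norm_zero]
    exact Finset.sum_nonneg fun _ _ => norm_nonneg _

/-- ★ **AT `U₀ = 1` THE CLASS FIELD `𝟙_{Λ_j}·(−i)LʲηQ_j(1)(iηA)` OF A BOUNDED HERMITIAN `A` IS HERMITIAN-VALUED**: the flat composite is ℂ-linear and star-compatible, so
`(−i)·Q_j(1)(iηA) = η·Q_j(1)A` is Hermitian. [cite: Balaban1985BackgroundPropagators, (3.16) p.393; Balaban1985RegularSpaces, (1.58) p.86; Balaban1985Averaging, (127) p.37] -/
theorem isSelfAdjoint_clsField_one [Nontrivial 𝔸] {L : ℕ} (hL : 1 ≤ L) (ΛbP : ℕ → ℕ → Set (Site d × Fin d)) (η : ℝ) (m j : ℕ) {A : Site d → Fin d → 𝔸}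
    (hA : ∀ w κ, IsSelfAdjoint (A w κ)) {b : ℝ} (hb : 0 ≤ b) (hAb : ∀ z κ, ‖A z κ‖ ≤ b) (z : Site d) (κ : Fin d) :
    IsSelfAdjoint (clsField L ΛbP η m j (1 : Site d → Fin d → 𝔸ˣ) A z κ) := by
  classical
  unfold clsField
  split_ifs with hmem
  · have hiEta : ∀ w ν, ‖iEta η A w ν‖ ≤ |η| * b := fun w ν => by
      rw [B8Eq146AExpansion.iEta_def]
      simp only [norm_smul, norm_mul, Complex.norm_I, one_mul, Complex.norm_real, Real.norm_eq_abs]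
      exact mul_le_mul_of_nonneg_left (hAb w ν) (abs_nonneg η)
    rw [B9Eq316TowerFlatIsOneStep.linCovIter_one_left L hL (iEta η A) (by positivity) hiEta j]
    have hI : iEta η A = ((Complex.I * η : ℂ)) • A := by funext w ν; rfl
    rw [hI, B7Prop4Flat.linQIter_csmul, smul_smul]
    have hc : -Complex.I * (Complex.I * (η : ℂ)) = (η : ℂ) := by
      rw [← mul_assoc, neg_mul, Complex.I_mul_I, neg_neg, one_mul]
    rw [hc, Complex.coe_smul]
    refine isSelfAdjoint_rsmul η ?_
    rw [IsSelfAdjoint, star_linQIter]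
    congr 1
    funext w ν
    exact (hA w ν).star_eq
  · exact IsSelfAdjoint.zero _

/-- ★★ **AT `U₀ = 1` THE GENUINE AVERAGING LETTER `Q*aQ` (EDITION P) MAPS BOUNDED HERMITIAN FIELDS TO HERMITIAN FIELDS** — `Σ_j w_j·Q_jᵀ(𝟙_{Λ_j}LʲηQ_j(1)A)` with real weights
`w_j`, Hermitian-valued class fields and Hermitian-preserving transposes (or `0` off the regime). [cite: Balaban1985BackgroundPropagators, (3.16) p.393, (3.26) p.395; Balaban1985RegularSpaces, (1.58) p.86] -/
theorem isSelfAdjoint_QQZdP_one [FiniteDimensional ℝ 𝔸] [Nontrivial 𝔸] {L : ℕ} (hL : 1 ≤ L) (hτp : ∀ a : 𝔸, a ≠ 0 → 0 < (τ (star a * a)).re)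
    (hτt : ∀ a b : 𝔸, τ (a * b) = τ (b * a)) (hτs : ∀ a : 𝔸, τ (star a) = starRingEnd ℂ (τ a))
    (ΛbP : ℕ → ℕ → Set (Site d × Fin d)) (i : ZdIdx d L) (m : ℕ) {A : Site d → Fin d → 𝔸}
    (hA : ∀ w κ, IsSelfAdjoint (A w κ)) {b : ℝ} (hb : 0 ≤ b) (hAb : ∀ z κ, ‖A z κ‖ ≤ b) (y : Site d) (μ : Fin d) :
    IsSelfAdjoint (QQZdP τ L ΛbP i m (1 : Site d → Fin d → 𝔸ˣ) A y μ) := by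
  by_cases h : Reg17 L m i.Ω (B9Eq316AveragingTransposeZd.alphaQ d L / (L : ℝ) ^ 2) (1 : Site d → Fin d → 𝔸ˣ)
  · rw [B9Eq316AveragingTransposeZdPrinted.QQZdP_of_reg17 τ L h]
    refine isSelfAdjoint_sum _ fun j _ => isSelfAdjoint_rsmul _ ?_
    exact isSelfAdjoint_linCovIterT_one τ hL hτp hτt hτs j (fun w κ => isSelfAdjoint_clsField_one hL ΛbP i.η m j hA hb hAb w κ) y μ
  · rw [B9Eq316AveragingTransposeZdPrinted.QQZdP_of_not_reg17 τ L h]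
    exact IsSelfAdjoint.zero _

end Flat

/-! ## §4 The four-letter `Δ_a(U₀)` of the genuine record -/

section Assembly

variable (τ : 𝔸 →ₗ[ℂ] ℂ) [FiniteDimensional ℝ 𝔸] {L : ℕ}

/-- ★★ **`Δ_a(U₀)A` IS HERMITIAN-VALUED AT A UNITARY BACKGROUND, MODULO THE AVERAGING LETTER**: for the genuine record `opsAllZd` at a member with finite `Ω₀`, a unitary `U₀`,
a Hermitian-valued `A`, and the displayed Hermiticity of `(Q*aQ)(U₀)A` at the bond: `(Δ_a(U₀)A)(b)` is Hermitian (`D*D`, `Δ′`, `DRD*` by §2).  The displayed letter is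
discharged at `U₀ = 1` below; at curved `U₀` it is the reality of the linearised covariant average ([Balaban1985Averaging] Prop. 3), not in the tree.
[cite: Balaban1985BackgroundPropagators, (3.26) p.395, (3.10) p.392, p.391] -/
theorem isSelfAdjoint_deltaAOf_opsAllZd_of_QQ (hτs : ∀ a : 𝔸, τ (star a) = starRingEnd ℂ (τ a)) (hτp : ∀ a : 𝔸, a ≠ 0 → 0 < (τ (star a * a)).re)
    (ΛbP : ℕ → ℕ → Set (Site d × Fin d)) (ops₀ : ℝ → ZdIdx d L → ℕ → OpsZd d 𝔸) (M : ℝ) (i : ZdIdx d L) (m : ℕ) (hΩ : (i.Ω 0).Finite)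
    {U₀ : Site d → Fin d → 𝔸ˣ} (hU : ∀ (x : Site d) (κ : Fin d), U₀ x κ ∈ unitaryUnits 𝔸)
    {A : Site d → Fin d → 𝔸} (hA : ∀ w κ, IsSelfAdjoint (A w κ)) (y : Site d) (μ : Fin d)
    (hQQ : IsSelfAdjoint ((opsAllZd τ L ΛbP ops₀ M i m).QQ U₀ A y μ)) :
    IsSelfAdjoint (deltaAOf i.η (opsAllZd τ L ΛbP ops₀ M i m) U₀ A y μ) := by
  have hstarA : star A = A := funext fun w => funext fun κ => (hA w κ).star_eq
  unfold deltaAOf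
  refine ((IsSelfAdjoint.add ?_ ?_).add ?_).add hQQ
  · rw [IsSelfAdjoint, star_Jcur hU, hstarA]
  · rw [B9SupplySockB9P3ZdAllLettersZd.opsAllZd_Dp, IsSelfAdjoint, star_DpZd hU, hstarA]
  · rw [B9SupplySockB9P3ZdAllLettersZd.opsAllZd_DRDs]
    exact isSelfAdjoint_DRDs_opsLandau τ _ M i m hΩ hτs hτp hU A y μ

/-- ★★★ **`Δ_a(1)` OF THE GENUINE FOUR-LETTER RECORD MAPS HERMITIAN FIELDS OF `E(Ω₀)` TO HERMITIAN BOND FIELDS** — dag-n06-b's displayed `HermPreservingAt i.η (opsAllZd τ L ΛbP ops₀ M i m)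
(i.Ω 0) 1`, unfolded (the conclusion holds at EVERY bond, touching `Ω₀` or not): `𝔸` finite-dimensional with a faithful Hermitian tracial `τ`, `1 ≤ L`, finite `Ω₀`, `A ∈ E(Ω₀)`
Hermitian-valued. [cite: Balaban1985BackgroundPropagators, p.391 («values in the algebra 𝔤 of hermitian matrices»), (3.26) p.395, (3.10) p.392, (3.16) p.393, (3.20)–(3.22) p.394] -/
theorem isSelfAdjoint_deltaAOf_opsAllZd_one [Nontrivial 𝔸] (hL : 1 ≤ L) (hτp : ∀ a : 𝔸, a ≠ 0 → 0 < (τ (star a * a)).re)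
    (hτt : ∀ a b : 𝔸, τ (a * b) = τ (b * a)) (hτs : ∀ a : 𝔸, τ (star a) = starRingEnd ℂ (τ a))
    (ΛbP : ℕ → ℕ → Set (Site d × Fin d)) (ops₀ : ℝ → ZdIdx d L → ℕ → OpsZd d 𝔸) (M : ℝ) (i : ZdIdx d L) (m : ℕ) (hΩ : (i.Ω 0).Finite)
    {A : Site d → Fin d → 𝔸} (hAdom : A ∈ domSub (𝔸 := 𝔸) (i.Ω 0)) (hA : ∀ w κ, IsSelfAdjoint (A w κ)) (y : Site d) (μ : Fin d) :
    IsSelfAdjoint (deltaAOf i.η (opsAllZd τ L ΛbP ops₀ M i m) (1 : Site d → Fin d → 𝔸ˣ) A y μ) := by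
  obtain ⟨b, hb, hAb⟩ := exists_bound_of_mem_domSub hΩ hAdom
  refine isSelfAdjoint_deltaAOf_opsAllZd_of_QQ τ hτs hτp ΛbP ops₀ M i m hΩ (fun _ _ => (unitaryUnits 𝔸).one_mem) hA y μ ?_
  rw [B9SupplySockB9P3ZdAllLettersZd.opsAllZd_QQ]
  exact isSelfAdjoint_QQZdP_one τ hL hτp hτt hτs ΛbP i m hA hb hAb y μ

end Assembly

end Literature.MathematicalPhysics.QuantumFieldTheory.Balaban1983to89.B9Eq326DeltaAHermitianZd

end
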